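import Mathlib
import Summits.Ventures.PercRepro2.HCov
import Summits.Ventures.PercRepro2.BHKOutside
import Summits.Ventures.PercRepro2.ISplit
import Summits.Ventures.PercRepro2.FirstOrderTerms

/-!
# The two-copy kernel of `W` and the `C₂`-exploration functionals (blind cell PercRepro2, p5 g22;
`proofs/P5-OEDGE.md` §28 addendum 2; the theorem `W ≥ 0` itself is `PendantW.lean`)

With `Q = {a₁ ↮ a₂}`, `PD`, `T` (`PDEvent`, `TEvent`), `D = P(PD)`, `t = P(T)`, `Q = P(Q)`, `β = P(b ↔ a₁)`,
`D₀ = P(a₃ ∉ C₁)`, `S_b = E[σ_b; Q] = P(Q, b ∈ C₁) − P(Q, b ∈ C₂)`, `c_g = P(PD ∪ T, b ∈ C₂) − P(T, b ∈ C₁)`: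

  **`W = (D − Q·D₀)·c_g + t·(D·β − D₀·S_b)`  (`= D·∂_gΨ(β) − Q·D₀·∂_gΨ(σ̄_b)`)  is ≥ 0**

on every instance (`W_nonneg`).  PROOF (a two-copy kernel): explore `K = C₂` under `a₁ ∉ K`; with
`r = 1_{a₁ ∉ K}`, `i = 1_{a₃ ∈ K}`, `j = 1_{b ∈ K}`, `u = 1_{a₁ ∉ K}·P_{G∖K}(a₃ ∈ C₁)`, `v = 1_{a₁ ∉ K}·P_{G∖K}(b ∈ C₁)`
(the exploration identities `D = E[(1 − i)(r − u)]`, `P(PD, bH) = E[(1 − i) j (r − u)]`, `t = E[i r]`,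
`P(T, bH) = E[i j r]`, `P(T, bL) = E[i v]`, `Q = E[r]`, `P(Q, bL) = E[v]`, `P(Q, bH) = E[j r]`), `W` is the
double sum `Σ_{ω, ω'} w(ω) w(ω') wKer(ω, ω')` with
`wKer = ((1 − i)(r − u) − D₀ r)·((1 − i')j'(r' − u') + r' i' j' − i' v') + r i·((1 − i')(r' − u') β − D₀ (v' − r' j'))`,
and the SYMMETRISED kernel `wKer(ω, ω') + wKer(ω', ω)` is non-negative POINTWISE (`wKer_symm_nonneg`) from
`0 ≤ u ≤ (1 − D₀) r` (monotonicity of `P_{G∖K}(a₃ ∈ C₁)`), `0 ≤ v ≤ β r` (`delClusterProb_le_beta`) and the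
indicator values: pattern `(a₃ ∉ K, a₃ ∉ K')`: `j'(1 − u')(1 − u − D₀) ≥ 0`; pattern `(a₃ ∉ K, a₃ ∈ K')`
symmetrised: `φ(β − m') + D₀(m' − m) − D₀ j φ ≥ 0` (`φ = 1 − u ∈ [D₀, 1]`, `m = v − j`) by the case split on
`X = β − m' − D₀ j`; pattern `(∈, ∈)`: `0`.
-/

namespace Summit.Ventures.PercRepro2

open UnionCluster

namespace CovForm

namespace FirstOrder

section Kernel

variable {R : Type*} [Field R] [LinearOrder R] [IsStrictOrderedRing R]

/-- The two-copy kernel of `W`: copy 1 = `(r, i, u)` (its `j, v` do not enter), copy 2 = `(r', i', j', u', v')`. -/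
def wKer (D₀ β r i u r' i' j' u' v' : R) : R :=
  ((1 - i) * (r - u) - D₀ * r) * ((1 - i') * j' * (r' - u') + r' * i' * j' - i' * v') +
    r * i * ((1 - i') * (r' - u') * β - D₀ * (v' - r' * j'))

/-- The mixed pattern (`i = 0`, `i' = 1`, both copies in `Q`): `φ(β − m') + D₀(m' − m) − D₀ j φ ≥ 0`
with `φ = 1 − u ∈ [D₀, 1]`, `m = v − j`, `m' = v' − j'`, `v, v' ≤ β`. -/
lemma wKer_mixed_nonneg (D₀ β j u v j' v' : R) (hD₀ : 0 ≤ D₀) (hD₁ : D₀ ≤ 1)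
    (hj : j = 0 ∨ j = 1) (hj' : j' = 0 ∨ j' = 1) (hu0 : 0 ≤ u) (hu : u ≤ 1 - D₀)
    (hv : v ≤ β) (hv' : v' ≤ β) :
    0 ≤ (1 - u - D₀) * (j' - v') + (- D₀ * j * (1 - u) + (1 - u) * β - D₀ * (v - j)) := by
  have hj0 : 0 ≤ j := by rcases hj with rfl | rfl <;> norm_num
  have hj0' : 0 ≤ j' := by rcases hj' with rfl | rfl <;> norm_num
  rcases le_or_gt 0 (β - (v' - j') - D₀ * j) with hX | hX
  · have h1 : 0 ≤ (1 - u - D₀) * (β - (v' - j') - D₀ * j) := mul_nonneg (by linarith) hX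
    have h2 : 0 ≤ D₀ * ((β - v) + j * (1 - D₀)) :=
      mul_nonneg hD₀ (add_nonneg (by linarith) (mul_nonneg hj0 (by linarith)))
    nlinarith [h1, h2]
  · rcases hj with rfl | rfl
    · exfalso; linarith
    · have h1 : 0 ≤ u * (-(β - (v' - j') - D₀ * 1)) := mul_nonneg hu0 (by linarith)
      have h2 : 0 ≤ (1 - D₀) * (β - v') := mul_nonneg (by linarith) (by linarith)
      have h3 : 0 ≤ D₀ * (β - v) := mul_nonneg hD₀ (by linarith)
      have h4 : 0 ≤ (1 - D₀) * j' := mul_nonneg (by linarith) hj0'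
      nlinarith [h1, h2, h3, h4]

/-- **The symmetrised kernel is non-negative** on the cube of indicators with `0 ≤ u ≤ (1 − D₀) r`,
`0 ≤ v ≤ β r`. -/
theorem wKer_symm_nonneg (D₀ β r i j u v r' i' j' u' v' : R) (hD₀ : 0 ≤ D₀) (hD₁ : D₀ ≤ 1)
    (hr : r = 0 ∨ r = 1) (hr' : r' = 0 ∨ r' = 1) (hi : i = 0 ∨ i = 1)
    (hi' : i' = 0 ∨ i' = 1) (hj : j = 0 ∨ j = 1) (hj' : j' = 0 ∨ j' = 1) (hu0 : 0 ≤ u)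
    (hu : u ≤ (1 - D₀) * r) (hu0' : 0 ≤ u') (hu' : u' ≤ (1 - D₀) * r') (hv0 : 0 ≤ v)
    (hv : v ≤ β * r) (hv0' : 0 ≤ v') (hv' : v' ≤ β * r') :
    0 ≤ wKer D₀ β r i u r' i' j' u' v' + wKer D₀ β r' i' u' r i j u v := by
  unfold wKer
  rcases hr with rfl | rfl
  · have hu1 : u = 0 := le_antisymm (by linarith) hu0
    have hv1 : v = 0 := le_antisymm (by linarith) hv0
    subst hu1 hv1
    ring_nf; exact le_refl _
  rcases hr' with rfl | rfl
  · have hu1 : u' = 0 := le_antisymm (by linarith) hu0'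
    have hv1 : v' = 0 := le_antisymm (by linarith) hv0'
    subst hu1 hv1
    ring_nf; exact le_refl _
  simp only [mul_one, one_mul] at hu hu' hv hv' ⊢
  have hj0 : 0 ≤ j := by rcases hj with rfl | rfl <;> norm_num
  have hj0' : 0 ≤ j' := by rcases hj' with rfl | rfl <;> norm_num
  rcases hi with rfl | rfl <;> rcases hi' with rfl | rfl
  · have h1 : 0 ≤ j' * ((1 - u') * (1 - u - D₀)) :=
      mul_nonneg hj0' (mul_nonneg (by linarith) (by linarith))
    have h2 : 0 ≤ j * ((1 - u) * (1 - u' - D₀)) :=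
      mul_nonneg hj0 (mul_nonneg (by linarith) (by linarith))
    nlinarith [h1, h2]
  · have h := wKer_mixed_nonneg D₀ β j u v j' v' hD₀ hD₁ hj hj' hu0 hu hv hv'
    nlinarith [h]
  · have h := wKer_mixed_nonneg D₀ β j' u' v' j v hD₀ hD₁ hj' hj hu0' hu' hv' hv
    nlinarith [h]
  · ring_nf; exact le_refl _

end Kernel

section Functionals

variable {V : Type*} {E : Type*} [Fintype E] [DecidableEq E] [Fintype V] [DecidableEq V]
  {R : Type*} [Field R] [LinearOrder R] [IsStrictOrderedRing R]

/-- `r = 1_{a₁ ∉ C₂}` (the indicator of `Q`). -/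
noncomputable def rI (ends : E → Sym2 V) (a₁ a₂ : V) (ω : Config E) : R :=
  (avoidAll ends a₂ {a₁}).indicator 1 ω
/-- `i = 1_{a₃ ∈ C₂}`. -/
noncomputable def iI (ends : E → Sym2 V) (a₂ a₃ : V) (ω : Config E) : R :=
  ({W : Set V | a₃ ∈ W}).indicator 1 (cluster ends ω a₂)
/-- `u = 1_{a₁ ∉ C₂} · P_{G ∖ C₂}(a₃ ∈ C₁)` (`outsideProb`). -/
noncomputable def uO (p : E → R) (ends : E → Sym2 V) (a₁ a₂ a₃ : V) (ω : Config E) : R :=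
  outsideProb p ends a₁ {W : Set V | a₃ ∈ W} (cluster ends ω a₂)

omit [Fintype E] [DecidableEq E] [Fintype V] [DecidableEq V] [LinearOrder R] [IsStrictOrderedRing R] in
/-- `{a₃ ∈ C(a₂)}` read on the cluster is the connection indicator. -/
lemma iI_eq_indicator (ends : E → Sym2 V) (a₂ a₃ : V) (ω : Config E) :
    (iI ends a₂ a₃ ω : R) = (connEvent ends a₂ a₃).indicator 1 ω := by
  unfold iI
  by_cases h : Conn ends ω a₂ a₃
  · rw [Set.indicator_of_mem (show cluster ends ω a₂ ∈ {W : Set V | a₃ ∈ W} from h),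
      Set.indicator_of_mem (show ω ∈ connEvent ends a₂ a₃ from h)]
    rfl
  · rw [Set.indicator_of_notMem (show cluster ends ω a₂ ∉ {W : Set V | a₃ ∈ W} from h),
      Set.indicator_of_notMem (show ω ∉ connEvent ends a₂ a₃ from h)]

omit [Fintype E] [DecidableEq E] [Fintype V] [DecidableEq V] [LinearOrder R] [IsStrictOrderedRing R] in
/-- `r ∈ {0, 1}`. -/
lemma rI_zero_or_one (ends : E → Sym2 V) (a₁ a₂ : V) (ω : Config E) :
    (rI ends a₁ a₂ ω : R) = 0 ∨ (rI ends a₁ a₂ ω : R) = 1 := by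
  unfold rI
  by_cases h : ω ∈ avoidAll ends a₂ {a₁}
  · right; rw [Set.indicator_of_mem h]; rfl
  · left; rw [Set.indicator_of_notMem h]

omit [Fintype E] [DecidableEq E] [Fintype V] [DecidableEq V] [LinearOrder R] [IsStrictOrderedRing R] in
/-- `i ∈ {0, 1}`. -/
lemma iI_zero_or_one (ends : E → Sym2 V) (a₂ a₃ : V) (ω : Config E) :
    (iI ends a₂ a₃ ω : R) = 0 ∨ (iI ends a₂ a₃ ω : R) = 1 := by
  unfold iI
  by_cases h : cluster ends ω a₂ ∈ {W : Set V | a₃ ∈ W}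
  · right; rw [Set.indicator_of_mem h]; rfl
  · left; rw [Set.indicator_of_notMem h]

omit [Fintype V] [DecidableEq V] in
/-- `0 ≤ u ≤ (1 − D₀)·r`: off `Q` both vanish; on `Q`, `P_{G∖K}(a₃ ∈ C₁) ≤ P(a₃ ∈ C₁) = 1 − D₀`. -/
lemma uO_bounds (p : E → R) (hp : IsProbVec p) (ends : E → Sym2 V) (a₁ a₂ a₃ : V) (ω : Config E) :
    0 ≤ uO p ends a₁ a₂ a₃ ω ∧ uO p ends a₁ a₂ a₃ ω ≤ (1 - D0 p ends a₁ a₃) * rI ends a₁ a₂ ω := by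
  unfold uO rI D0
  by_cases h : a₁ ∈ cluster ends ω a₂
  · rw [outsideProb_apply_of_mem p _ h]
    have hnot : ω ∉ avoidAll ends a₂ {a₁} := fun hav =>
      (notMem_cluster_of_mem_avoidAll (Finset.mem_singleton_self a₁) hav) h
    rw [Set.indicator_of_notMem hnot]
    simp
  · rw [outsideProb_apply_of_notMem p _ h]
    have hmem : ω ∈ avoidAll ends a₂ {a₁} := by
      intro x hx
      rw [Finset.mem_singleton] at hx
      subst hx
      exact fun hc => h hc
    rw [Set.indicator_of_mem hmem]
    refine ⟨delClusterProb_nonneg p hp ends a₁ _ _, ?_⟩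
    have hanti := delClusterProb_anti p hp ends a₁ (isUpperSet_mem_setOf a₃)
      (Set.empty_subset (cluster ends ω a₂))
    rw [delClusterProb_empty p ends a₁] at hanti
    have hc : prob p (clusterInEvent ends a₁ {W : Set V | a₃ ∈ W}) = 1 - prob p (avoidAll ends a₁ {a₃}) := by
      rw [← connEvent_eq_clusterInEvent, ← prob_compl]
      congr 1
      ext ω'
      simp only [Set.mem_compl_iff, mem_connEvent, mem_avoidAll, Finset.mem_singleton, forall_eq,
        not_not]
    simp only [Pi.one_apply, mul_one]
    linarith

omit [Fintype V] [DecidableEq V] in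
/-- `0 ≤ v ≤ β·r` for `v = outsideProb a₁ {b ∈ ·} C₂`. -/
lemma vO_bounds (p : E → R) (hp : IsProbVec p) (ends : E → Sym2 V) (a₁ a₂ b : V) (ω : Config E) :
    0 ≤ outsideProb p ends a₁ {W : Set V | b ∈ W} (cluster ends ω a₂) ∧
      outsideProb p ends a₁ {W : Set V | b ∈ W} (cluster ends ω a₂) ≤
        beta p ends a₁ b * rI ends a₁ a₂ ω := by
  unfold rI
  by_cases h : a₁ ∈ cluster ends ω a₂
  · rw [outsideProb_apply_of_mem p _ h]
    have hnot : ω ∉ avoidAll ends a₂ {a₁} := fun hav =>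
      (notMem_cluster_of_mem_avoidAll (Finset.mem_singleton_self a₁) hav) h
    rw [Set.indicator_of_notMem hnot]
    simp
  · rw [outsideProb_apply_of_notMem p _ h]
    have hmem : ω ∈ avoidAll ends a₂ {a₁} := by
      intro x hx
      rw [Finset.mem_singleton] at hx
      subst hx
      exact fun hc => h hc
    rw [Set.indicator_of_mem hmem]
    simp only [Pi.one_apply, mul_one]
    exact ⟨delClusterProb_nonneg p hp ends a₁ _ _, delClusterProb_le_beta p hp ends a₁ b _⟩

end Functionals

section Masses

variable {V : Type*} {E : Type*} [Fintype E] [DecidableEq E] [Fintype V] [DecidableEq V]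
  {R : Type*} [Field R] [LinearOrder R] [IsStrictOrderedRing R]

omit [LinearOrder R] [IsStrictOrderedRing R] in
/-- **Exploration of `C₂` under `a₁ ∉ C₂`, with an outside event of `C₁`**:
`P(C₂ ∈ 𝓤, C₁ ∈ 𝓥, a₁ ∉ C₂) = E[1_𝓤(C₂) · outsideProb_{a₁,𝓥}(C₂)]`. -/
lemma prob_explore_C2 (p : E → R) (ends : E → Sym2 V) (a₁ a₂ : V) (𝓤 𝓥 : Set (Set V)) :
    prob p (clusterInEvent ends a₂ 𝓤 ∩ clusterInEvent ends a₁ 𝓥 ∩ avoidAll ends a₂ {a₁}) =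
      expect p (fun ω => 𝓤.indicator 1 (cluster ends ω a₂) *
        outsideProb p ends a₁ 𝓥 (cluster ends ω a₂)) := by
  have h := prob_clusterIn_outside_inter_avoid_eq_expect p ends a₂ a₁ (∅ : Finset V) 𝓤 𝓥
  rw [Finset.insert_empty] at h
  rw [h]
  refine congrArg (expect p) (funext fun ω => ?_)
  have huniv : ω ∈ avoidAll ends a₂ (∅ : Finset V) := fun x hx => absurd hx (Finset.notMem_empty x)
  rw [Set.indicator_of_mem huniv]
  simp

omit [Fintype V] [DecidableEq V] [LinearOrder R] [IsStrictOrderedRing R] in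
/-- **A `C₂`-event on `Q`**: `P(C₂ ∈ 𝓤, a₁ ∉ C₂) = E[1_𝓤(C₂) · r]`. -/
lemma prob_C2_event (p : E → R) (ends : E → Sym2 V) (a₁ a₂ : V) (𝓤 : Set (Set V)) :
    prob p (clusterInEvent ends a₂ 𝓤 ∩ avoidAll ends a₂ {a₁}) =
      expect p (fun ω => 𝓤.indicator 1 (cluster ends ω a₂) * rI ends a₁ a₂ ω) := by
  rw [prob_eq_expect_indicator]
  refine congrArg (expect p) (funext fun ω => ?_)
  unfold rI
  rw [Set.inter_indicator_one, Pi.mul_apply]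
  by_cases h : cluster ends ω a₂ ∈ 𝓤
  · rw [Set.indicator_of_mem h, Set.indicator_of_mem (show ω ∈ clusterInEvent ends a₂ 𝓤 from h)]
    rfl
  · rw [Set.indicator_of_notMem h, Set.indicator_of_notMem (show ω ∉ clusterInEvent ends a₂ 𝓤 from h)]

omit [Fintype E] [DecidableEq E] [Fintype V] [DecidableEq V] [LinearOrder R] [IsStrictOrderedRing R] in
/-- `1_{a₃ ∉ ·}(C₂) = 1 − i`. -/
lemma indicator_notMem_eq (ends : E → Sym2 V) (a₂ a₃ : V) (ω : Config E) :
    ({W : Set V | a₃ ∉ W}).indicator (1 : Set V → R) (cluster ends ω a₂) = 1 - iI ends a₂ a₃ ω := by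
  unfold iI
  by_cases h : a₃ ∈ cluster ends ω a₂
  · rw [Set.indicator_of_notMem (show cluster ends ω a₂ ∉ {W : Set V | a₃ ∉ W} from fun h' => h' h),
      Set.indicator_of_mem (show cluster ends ω a₂ ∈ {W : Set V | a₃ ∈ W} from h)]
    simp
  · rw [Set.indicator_of_mem (show cluster ends ω a₂ ∈ {W : Set V | a₃ ∉ W} from h),
      Set.indicator_of_notMem (show cluster ends ω a₂ ∉ {W : Set V | a₃ ∈ W} from h)]
    simp

omit [Fintype E] [DecidableEq E] [Fintype V] [DecidableEq V] [LinearOrder R] [IsStrictOrderedRing R] in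
/-- `1_{a₃ ∉ · ∧ b ∈ ·}(C₂) = (1 − i)·j`. -/
lemma indicator_notMem_mem_eq (ends : E → Sym2 V) (a₂ a₃ b : V) (ω : Config E) :
    ({W : Set V | a₃ ∉ W ∧ b ∈ W}).indicator (1 : Set V → R) (cluster ends ω a₂) =
      (1 - iI ends a₂ a₃ ω) * ({W : Set V | b ∈ W}).indicator 1 (cluster ends ω a₂) := by
  have e : ({W : Set V | a₃ ∉ W ∧ b ∈ W}) = {W : Set V | a₃ ∉ W} ∩ {W : Set V | b ∈ W} := by
    ext W; simp
  rw [e, Set.inter_indicator_one, Pi.mul_apply, indicator_notMem_eq]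

omit [Fintype E] [DecidableEq E] [Fintype V] [DecidableEq V] [LinearOrder R] [IsStrictOrderedRing R] in
/-- `1_{a₃ ∈ · ∧ b ∈ ·}(C₂) = i·j`. -/
lemma indicator_mem_mem_eq (ends : E → Sym2 V) (a₂ a₃ b : V) (ω : Config E) :
    ({W : Set V | a₃ ∈ W ∧ b ∈ W}).indicator (1 : Set V → R) (cluster ends ω a₂) =
      iI ends a₂ a₃ ω * ({W : Set V | b ∈ W}).indicator 1 (cluster ends ω a₂) := by
  have e : ({W : Set V | a₃ ∈ W ∧ b ∈ W}) = {W : Set V | a₃ ∈ W} ∩ {W : Set V | b ∈ W} := by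
    ext W; simp
  rw [e, Set.inter_indicator_one, Pi.mul_apply]
  rfl

omit [Fintype E] [DecidableEq E] [Fintype V] in
/-- `PD = ({a₃ ∉ C₂} ∩ Q) ∩ {a₃ ∈ C₁}ᶜ`. -/
lemma PDEvent_eq_explore (ends : E → Sym2 V) (a₁ a₂ a₃ : V) :
    PDEvent ends a₁ a₂ a₃ =
      (clusterInEvent ends a₂ {W : Set V | a₃ ∉ W} ∩ avoidAll ends a₂ {a₁}) ∩
        (clusterInEvent ends a₁ {W : Set V | a₃ ∈ W})ᶜ := by
  rw [ISplit.PD_eq_R_inter]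
  ext ω
  simp only [Set.mem_inter_iff, Set.mem_compl_iff, mem_clusterInEvent, Set.mem_setOf_eq, mem_cluster,
    mem_avoidAll, mem_connEvent, Finset.mem_insert, Finset.mem_singleton, forall_eq_or_imp, forall_eq]
  constructor
  · rintro ⟨⟨h12, h13⟩, h23⟩
    exact ⟨⟨h23, fun h21 => h12 (conn_symm h21)⟩, h13⟩
  · rintro ⟨⟨h23, h21⟩, h13⟩
    exact ⟨⟨fun h12 => h21 (conn_symm h12), h13⟩, h23⟩

omit [Fintype E] [DecidableEq E] [Fintype V] in
/-- `PD ∩ {b ∈ C₂} = ({a₃ ∉ C₂, b ∈ C₂} ∩ Q) ∩ {a₃ ∈ C₁}ᶜ`. -/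
lemma PDEvent_inter_bH_eq_explore (ends : E → Sym2 V) (a₁ a₂ a₃ b : V) :
    PDEvent ends a₁ a₂ a₃ ∩ connEvent ends a₂ b =
      (clusterInEvent ends a₂ {W : Set V | a₃ ∉ W ∧ b ∈ W} ∩ avoidAll ends a₂ {a₁}) ∩
        (clusterInEvent ends a₁ {W : Set V | a₃ ∈ W})ᶜ := by
  rw [PDEvent_eq_explore]
  ext ω
  simp only [Set.mem_inter_iff, Set.mem_compl_iff, mem_clusterInEvent, Set.mem_setOf_eq, mem_cluster,
    mem_connEvent]
  tauto

omit [Fintype E] [DecidableEq E] [Fintype V] [DecidableEq V] in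
/-- `T = {a₃ ∈ C₂} ∩ Q`. -/
lemma TEvent_eq_explore (ends : E → Sym2 V) (a₁ a₂ a₃ : V) :
    TEvent ends a₁ a₂ a₃ = clusterInEvent ends a₂ {W : Set V | a₃ ∈ W} ∩ avoidAll ends a₂ {a₁} := by
  ext ω
  simp only [TEvent, Set.mem_inter_iff, Set.mem_compl_iff, mem_connEvent, mem_clusterInEvent,
    Set.mem_setOf_eq, mem_cluster, mem_avoidAll, Finset.mem_singleton, forall_eq]
  tauto

end Masses

end FirstOrder

end CovForm

end Summit.Ventures.PercRepro2
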